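import Summits.QuantumFields.GaugeBoot.GaugeStringDualityRate
import HarnessLib

/-!
# The contraction with a source term, and the exact equation of the rescaled error `N(φ_N − T)` (gauge-boot, ADDENDUM 29 part A)

HONEST FRAMING (cell `pub-gaugeboot`, page 1 of every file): the venture produces certified bounds
on lattice expectations at stated coupling, gauge group, dimension and torus size; NOT a mass gap,
NOT a continuum limit, NOT a string tension; NOT Yang–Mills-summit-bearing (barriers
`FixedCouplingUltralocality`, `PerturbativeInvisibility`).  Strong-coupling `SO(N)` lattice gauge theory with free boundary
condition at finite `N` and finite volume (S. Chatterjee, Comm. Math. Phys. **366** (2019)); nothing about four-dimensional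
continuum Yang–Mills or a mass gap.

## Content

Towards the FIRST-ORDER `1/N` CORRECTION to gauge–string duality (the `1/N` expansion of Chatterjee–Jafarov at first order):
* `contraction_step`, ★ `contraction_iterate` — the Catalan-weighted contraction of ADDENDUM 28 for ONE function `f` with a
  SOURCE: if `f(∅) = 0`, `|f| ≤ B·Φ` at the leaves of a depth grading compatible with the moves, and
  `| |s| f(s) − (Σ_{𝕊⁻} f − Σ_{𝕊⁺} f + βΣ_{𝔻⁻} f − βΣ_{𝔻⁺} f) | ≤ η |s| Φ(s)` at the inner nodes, then at depth `n`
  `|f(s)| ≤ (B θⁿ + 4η) Φ(s)` (`θ ≤ 3/4`);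
* ★ `psi_equation` — the EXACT equation of `ψ_N := N(φ_{Λ,N,β} − T)` (`T` the string sum): for a genuine non-null `s` with its
  unit vertex neighbourhood in `Λ`,
  `|s| ψ_N(s) − (Σ_{𝕊⁻} ψ_N − Σ_{𝕊⁺} ψ_N + βΣ_{𝔻⁻} ψ_N − βΣ_{𝔻⁺} ψ_N) = |s| φ_N(s) + Σ_{𝕋⁻} φ_N − Σ_{𝕋⁺} φ_N + N⁻¹(Σ_{𝕄⁻} φ_N − Σ_{𝕄⁺} φ_N)`
  (the source term of the first-order correction: the finite-`N` master loop equation of Theorem 3.6 minus the exact symmetrized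
  equation of `T`).

Everything is `[folklore]` given the source and ADDENDUM 28.
-/

noncomputable section

open Finset Filter Topology
open Literature.MathematicalPhysics.QuantumFieldTheory (latticeNorm)
open Literature.MathematicalPhysics.QuantumFieldTheory.Chatterjee2019LargeN
open Literature.MathematicalPhysics.QuantumFieldTheory.Chatterjee2019LargeN.CoeffCatalanBoundProof

namespace Summit.QuantumFields.GaugeBoot

namespace StringDuality

variable {d : ℕ}

/-! ## The contraction with a source -/

/-- **One step of the contraction, with a source**: if `| |s| f(s) − RHS(f)(s) | ≤ A` and `|f| ≤ c·Φ` on the splitting and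
deformation results of `s`, then `|f(s)| ≤ cθ Φ(s) + A/|s|` for any `θ ≥ 2/K + |β|·2·2(d−1)·256·K⁴`.
[cite: Chatterjee2019LargeN, Theorem 9.9, Lemma 10.1] -/
theorem contraction_step {K θ c β A : ℝ} (hK1 : 1 ≤ K) (hc0 : 0 ≤ c)
    (hθ : 2 / K + |β| * (2 * ((2 * (d - 1) : ℕ) : ℝ) * 256 * K ^ 4) ≤ θ)
    {s : LoopSeq d} (hs : IsLoopSeq s) (hne : s ≠ []) (f : LoopSeq d → ℝ)
    (hA : |(s.len : ℝ) * f s -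
        ((∑ o : InvIdx s, f (s.negSplitAt o)) - (∑ o : SameIdx s, f (s.posSplitAt o))
          + β * (∑ o : DeformIdx s, f (s.negDeformAt o)) - β * (∑ o : DeformIdx s, f (s.posDeformAt o)))| ≤ A)
    (hI : ∀ o : InvIdx s, |f (s.negSplitAt o)| ≤ c * (K ^ (s.negSplitAt o).index * catProd (s.negSplitAt o)))
    (hS : ∀ o : SameIdx s, |f (s.posSplitAt o)| ≤ c * (K ^ (s.posSplitAt o).index * catProd (s.posSplitAt o)))
    (hDn : ∀ o : DeformIdx s, |f (s.negDeformAt o)| ≤ c * (K ^ (s.negDeformAt o).index * catProd (s.negDeformAt o)))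
    (hDp : ∀ o : DeformIdx s, |f (s.posDeformAt o)| ≤ c * (K ^ (s.posDeformAt o).index * catProd (s.posDeformAt o))) :
    |f s| ≤ c * θ * (K ^ s.index * catProd s) + A / s.len := by
  have hK0 : 0 < K := by linarith
  have hlen : (0 : ℝ) < s.len := by exact_mod_cast LoopSeq.len_pos hs hne
  have hΦ0 : 0 ≤ K ^ s.index * catProd s := mul_nonneg (pow_nonneg hK0.le _) (catProd_nonneg _)
  set S₁ : ℝ := ∑ o : InvIdx s, K ^ (s.negSplitAt o).index * catProd (s.negSplitAt o) with hS₁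
  set S₂ : ℝ := ∑ o : SameIdx s, K ^ (s.posSplitAt o).index * catProd (s.posSplitAt o) with hS₂
  set S₃ : ℝ := ∑ o : DeformIdx s, K ^ (s.negDeformAt o).index * catProd (s.negDeformAt o) with hS₃
  set S₄ : ℝ := ∑ o : DeformIdx s, K ^ (s.posDeformAt o).index * catProd (s.posDeformAt o) with hS₄
  have e1 : |∑ o : InvIdx s, f (s.negSplitAt o)| ≤ c * S₁ := by
    refine (Finset.abs_sum_le_sum_abs _ _).trans ?_
    rw [hS₁, Finset.mul_sum]; exact Finset.sum_le_sum fun o _ => hI o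
  have e2 : |∑ o : SameIdx s, f (s.posSplitAt o)| ≤ c * S₂ := by
    refine (Finset.abs_sum_le_sum_abs _ _).trans ?_
    rw [hS₂, Finset.mul_sum]; exact Finset.sum_le_sum fun o _ => hS o
  have e3 : |∑ o : DeformIdx s, f (s.negDeformAt o)| ≤ c * S₃ := by
    refine (Finset.abs_sum_le_sum_abs _ _).trans ?_
    rw [hS₃, Finset.mul_sum]; exact Finset.sum_le_sum fun o _ => hDn o
  have e4 : |∑ o : DeformIdx s, f (s.posDeformAt o)| ≤ c * S₄ := by
    refine (Finset.abs_sum_le_sum_abs _ _).trans ?_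
    rw [hS₄, Finset.mul_sum]; exact Finset.sum_le_sum fun o _ => hDp o
  set R : ℝ := (∑ o : InvIdx s, f (s.negSplitAt o)) - (∑ o : SameIdx s, f (s.posSplitAt o))
      + β * (∑ o : DeformIdx s, f (s.negDeformAt o)) - β * (∑ o : DeformIdx s, f (s.posDeformAt o)) with hR
  have hRle : |R| ≤ c * ((S₁ + S₂) + |β| * (S₃ + S₄)) := by
    have e : R = ((∑ o : InvIdx s, f (s.negSplitAt o)) - ∑ o : SameIdx s, f (s.posSplitAt o))
        + β * ((∑ o : DeformIdx s, f (s.negDeformAt o)) - ∑ o : DeformIdx s, f (s.posDeformAt o)) := by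
      rw [hR]; ring
    rw [e]
    calc _ ≤ |(∑ o : InvIdx s, f (s.negSplitAt o)) - ∑ o : SameIdx s, f (s.posSplitAt o)|
          + |β * ((∑ o : DeformIdx s, f (s.negDeformAt o)) - ∑ o : DeformIdx s, f (s.posDeformAt o))| := abs_add_le _ _
      _ ≤ (c * S₁ + c * S₂) + |β| * (c * S₃ + c * S₄) := by
          refine add_le_add ((abs_sub _ _).trans (add_le_add e1 e2)) ?_
          rw [abs_mul]
          exact mul_le_mul_of_nonneg_left ((abs_sub _ _).trans (add_le_add e3 e4)) (abs_nonneg β)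
      _ = c * ((S₁ + S₂) + |β| * (S₃ + S₄)) := by ring
  have hop : (S₁ + S₂) + |β| * (S₃ + S₄) ≤ (s.len : ℝ) * (θ * (K ^ s.index * catProd s)) :=
    (operator_weight_le hK1 β hs hne).trans
      (mul_le_mul_of_nonneg_left (mul_le_mul_of_nonneg_right hθ hΦ0) hlen.le)
  have hkey : (s.len : ℝ) * |f s| ≤ A + c * ((s.len : ℝ) * (θ * (K ^ s.index * catProd s))) := by
    calc (s.len : ℝ) * |f s| = |((s.len : ℝ) * f s - R) + R| := by
          rw [sub_add_cancel, abs_mul, abs_of_pos hlen]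
      _ ≤ |(s.len : ℝ) * f s - R| + |R| := abs_add_le _ _
      _ ≤ A + c * ((s.len : ℝ) * (θ * (K ^ s.index * catProd s))) :=
          add_le_add hA (hRle.trans (mul_le_mul_of_nonneg_left hop hc0))
  have h1 : |f s| ≤ (A + c * ((s.len : ℝ) * (θ * (K ^ s.index * catProd s)))) / s.len := by
    rw [le_div_iff₀ hlen, mul_comm]; exact hkey
  calc |f s| ≤ (A + c * ((s.len : ℝ) * (θ * (K ^ s.index * catProd s)))) / s.len := h1
    _ = c * θ * (K ^ s.index * catProd s) + A / s.len := by field_simp; ring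

/-- ★ **The contraction with a source, iterated along a depth grading.**  `Good : ℕ → 𝒮 → Prop` is compatible with the moves
and carries (i) at depth `0` the a priori bound `|f| ≤ B·Φ`, (ii) at depth `m + 1` the source bound
`| |s| f(s) − RHS(f)(s) | ≤ η |s| Φ(s)` together with depth `m` of all splitting/deformation results.  Then, with `K ≥ 4` and
`θ := 2/K + |β|·1024(d−1)K⁴ ≤ 3/4`, at depth `n`: `|f(s)| ≤ (B θⁿ + 4η) Φ(s)` (`f(∅) = 0`).
[cite: Chatterjee2019LargeN, Theorem 9.9, Lemma 10.1] -/
theorem contraction_iterate {K β B η : ℝ} (hK4 : 4 ≤ K) (hB : 0 ≤ B) (hη : 0 ≤ η)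
    (hθ : 2 / K + |β| * (2 * ((2 * (d - 1) : ℕ) : ℝ) * 256 * K ^ 4) ≤ 3 / 4)
    (f : LoopSeq d → ℝ) (h0 : f [] = 0) (Good : ℕ → LoopSeq d → Prop)
    (hleaf : ∀ s : LoopSeq d, IsLoopSeq s → Good 0 s → |f s| ≤ B * (K ^ s.index * catProd s))
    (hnode : ∀ (m : ℕ) (s : LoopSeq d), Good (m + 1) s →
      (IsLoopSeq s → s ≠ [] →
        |(s.len : ℝ) * f s -
          ((∑ o : InvIdx s, f (s.negSplitAt o)) - (∑ o : SameIdx s, f (s.posSplitAt o))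
            + β * (∑ o : DeformIdx s, f (s.negDeformAt o)) - β * (∑ o : DeformIdx s, f (s.posDeformAt o)))| ≤
          η * s.len * (K ^ s.index * catProd s)) ∧
      (∀ o : SameIdx s, Good m (s.posSplitAt o)) ∧ (∀ o : InvIdx s, Good m (s.negSplitAt o)) ∧
      (∀ o : DeformIdx s, Good m (s.posDeformAt o)) ∧ (∀ o : DeformIdx s, Good m (s.negDeformAt o))) :
    ∀ (n : ℕ) (s : LoopSeq d), IsLoopSeq s → Good n s →
      |f s| ≤ (B * (2 / K + |β| * (2 * ((2 * (d - 1) : ℕ) : ℝ) * 256 * K ^ 4)) ^ n + 4 * η) *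
        (K ^ s.index * catProd s) := by
  obtain ⟨θ, hθdef⟩ : ∃ θ : ℝ, θ = 2 / K + |β| * (2 * ((2 * (d - 1) : ℕ) : ℝ) * 256 * K ^ 4) := ⟨_, rfl⟩
  rw [← hθdef] at hθ ⊢
  have hK1 : 1 ≤ K := by linarith
  have hK0 : 0 < K := by linarith
  have hθ0 : 0 ≤ θ := by rw [hθdef]; positivity
  intro n
  induction n with
  | zero =>
    intro s hs hg
    have hΦ0 : 0 ≤ K ^ s.index * catProd s := mul_nonneg (pow_nonneg hK0.le _) (catProd_nonneg _)
    calc |f s| ≤ B * (K ^ s.index * catProd s) := hleaf s hs hg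
      _ ≤ (B * θ ^ 0 + 4 * η) * (K ^ s.index * catProd s) := by
          rw [pow_zero, mul_one]
          exact mul_le_mul_of_nonneg_right (by linarith) hΦ0
  | succ n ih =>
    intro s hs hg
    obtain ⟨hsrc, hS, hI, hDp, hDn⟩ := hnode n s hg
    have hΦ0 : 0 ≤ K ^ s.index * catProd s := mul_nonneg (pow_nonneg hK0.le _) (catProd_nonneg _)
    by_cases hne : s = []
    · subst hne; rw [h0, abs_zero]; positivity
    have hlen : (0 : ℝ) < s.len := by exact_mod_cast LoopSeq.len_pos hs hne
    have hc0 : 0 ≤ B * θ ^ n + 4 * η := by positivity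
    have hstep := contraction_step (β := β) hK1 hc0 (le_of_eq hθdef.symm) hs hne f (hsrc hs hne)
      (fun o => ih _ (hs.negSplitAt o) (hI o)) (fun o => ih _ (hs.posSplitAt o) (hS o))
      (fun o => ih _ (hs.negDeformAt o) (hDn o)) (fun o => ih _ (hs.posDeformAt o) (hDp o))
    have hdiv : η * (s.len : ℝ) * (K ^ s.index * catProd s) / s.len = η * (K ^ s.index * catProd s) := by
      field_simp
    rw [hdiv] at hstep
    calc |f s| ≤ (B * θ ^ n + 4 * η) * θ * (K ^ s.index * catProd s) + η * (K ^ s.index * catProd s) := hstep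
      _ = ((B * θ ^ n + 4 * η) * θ + η) * (K ^ s.index * catProd s) := by ring
      _ ≤ (B * θ ^ (n + 1) + 4 * η) * (K ^ s.index * catProd s) := by
          refine mul_le_mul_of_nonneg_right ?_ hΦ0
          have : (B * θ ^ n + 4 * η) * θ + η = B * θ ^ (n + 1) + (4 * η * θ + η) := by ring
          rw [this]
          have h4 : 4 * η * θ ≤ 4 * η * (3 / 4) := mul_le_mul_of_nonneg_left hθ (by positivity)
          linarith

/-! ## The exact equation of `ψ_N = N(φ_N − T)` -/

/-- ★ **The exact equation of the rescaled error.**  For `N ≥ 2`, a non-empty `Λ`, `|β| ≤ 1/(2K(d)⁵)` and a genuine non-null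
`s` with its unit vertex neighbourhood in `Λ`, the function `ψ_N := N(φ_{Λ,N,β} − T)` (`T` the string sum) satisfies the
symmetrized equation with the SOURCE `|s|φ_N(s) + Σ_{𝕋⁻}φ_N − Σ_{𝕋⁺}φ_N + N⁻¹(Σ_{𝕄⁻}φ_N − Σ_{𝕄⁺}φ_N)`.
[cite: Chatterjee2019LargeN, Theorem 3.6, Theorem 9.9] -/
theorem psi_equation (hd : 2 ≤ d) {Λ : Finset (Literature.Probability.LatticeModels.Site d)} (hΛ : Λ.Nonempty)
    {N : ℕ} (hN : 2 ≤ N) {β : ℝ} (hβ : |β| ≤ 1 / (2 * bigK d ^ 5)) {s : LoopSeq d} (hs : IsLoopSeq s) (hne : s ≠ [])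
    (hV : ∀ l ∈ s, ∀ a ∈ l, ∀ v : Literature.Probability.LatticeModels.Site d,
      latticeNorm (v - DEdge.src a) ≤ 1 ∨ latticeNorm (v - DEdge.tgt a) ≤ 1 → v ∈ Λ) :
    let ψ : LoopSeq d → ℝ := fun t => (N : ℝ) * (phi N β Λ t - ∑' X : Trajectory t, X.weight β)
    (s.len : ℝ) * ψ s -
        ((∑ o : InvIdx s, ψ (s.negSplitAt o)) - (∑ o : SameIdx s, ψ (s.posSplitAt o))
          + β * (∑ o : DeformIdx s, ψ (s.negDeformAt o)) - β * (∑ o : DeformIdx s, ψ (s.posDeformAt o))) =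
      (s.len : ℝ) * phi N β Λ s
        + ((∑ o : SameIdx s, phi N β Λ (s.negTwistAt o)) - ∑ o : InvIdx s, phi N β Λ (s.posTwistAt o))
        + (1 / (N : ℝ)) * ((∑ o : MergeIdx s, phi N β Λ (s.negMergeAt o)) - ∑ o : MergeIdx s, phi N β Λ (s.posMergeAt o)) := by
  intro ψ
  have h := SOMasterLoop.finiteNMasterLoopEquation_holds d hd Λ hΛ N hN β s hs hne hV
  have hT := trajectorySum_equation hβ hs hne
  have hN0 : (N : ℝ) ≠ 0 := by exact_mod_cast (by omega : N ≠ 0)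
  simp only [ψ, mul_sub, Finset.sum_sub_distrib, Finset.mul_sum]
  -- abbreviations
  set L : ℝ := (s.len : ℝ)
  set F := phi N β Λ
  set Tw : ℝ := (∑ o : SameIdx s, F (s.negTwistAt o)) - ∑ o : InvIdx s, F (s.posTwistAt o) with hTw
  set Me : ℝ := (∑ o : MergeIdx s, F (s.negMergeAt o)) - ∑ o : MergeIdx s, F (s.posMergeAt o) with hMe
  set Sp : ℝ := (∑ o : InvIdx s, F (s.negSplitAt o)) - ∑ o : SameIdx s, F (s.posSplitAt o) with hSp
  set De : ℝ := (∑ o : DeformIdx s, F (s.negDeformAt o)) - ∑ o : DeformIdx s, F (s.posDeformAt o) with hDe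
  set SpT : ℝ := (∑ o : InvIdx s, ∑' X : Trajectory (s.negSplitAt o), X.weight β)
      - ∑ o : SameIdx s, ∑' X : Trajectory (s.posSplitAt o), X.weight β with hSpT
  set DeT : ℝ := (∑ o : DeformIdx s, ∑' X : Trajectory (s.negDeformAt o), X.weight β)
      - ∑ o : DeformIdx s, ∑' X : Trajectory (s.posDeformAt o), X.weight β with hDeT
  have h' : ((N : ℝ) - 1) * L * F s = Tw + N * Sp + (1 / (N : ℝ)) * Me + N * β * De := by
    rw [h, hTw, hSp, hMe, hDe]; ring
  have hT' : L * (∑' X : Trajectory s, X.weight β) = SpT + β * DeT := by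
    rw [hT, hSpT, hDeT]; ring
  -- both sides are polynomial in the abbreviations
  have goal_eq : L * ((N : ℝ) * F s) - L * ((N : ℝ) * ∑' X : Trajectory s, X.weight β) -
      ((∑ o : InvIdx s, (N : ℝ) * F (s.negSplitAt o)) -
            (∑ o : InvIdx s, (N : ℝ) * ∑' X : Trajectory (s.negSplitAt o), X.weight β) -
          ((∑ o : SameIdx s, (N : ℝ) * F (s.posSplitAt o)) -
            ∑ o : SameIdx s, (N : ℝ) * ∑' X : Trajectory (s.posSplitAt o), X.weight β) +
        ((∑ o : DeformIdx s, β * ((N : ℝ) * F (s.negDeformAt o))) -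
          ∑ o : DeformIdx s, β * ((N : ℝ) * ∑' X : Trajectory (s.negDeformAt o), X.weight β)) -
        ((∑ o : DeformIdx s, β * ((N : ℝ) * F (s.posDeformAt o))) -
          ∑ o : DeformIdx s, β * ((N : ℝ) * ∑' X : Trajectory (s.posDeformAt o), X.weight β))) =
      N * (L * F s - Sp - β * De) - N * (L * (∑' X : Trajectory s, X.weight β) - SpT - β * DeT) := by
    rw [hSp, hDe, hSpT, hDeT]
    simp only [← Finset.mul_sum]
    ring
  rw [goal_eq, hT']
  have e2 : (N : ℝ) * (L * F s - Sp - β * De) = L * F s + Tw + (1 / (N : ℝ)) * Me := by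
    have : (N : ℝ) * (L * F s - Sp - β * De) = N * L * F s - (((N : ℝ) - 1) * L * F s - Tw - (1 / (N : ℝ)) * Me) := by
      rw [h']; ring
    rw [this]; ring
  rw [e2, hMe, mul_sub, Finset.mul_sum, Finset.mul_sum]
  ring

end StringDuality

end Summit.QuantumFields.GaugeBoot

end
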